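import Literature.AnabelianGeometry.EtaleTheta.DoubleUnderlineOfCocycle
import Literature.AnabelianGeometry.EtaleTheta.LDeltaThetaIndex
import Literature.AnabelianGeometry.EtaleTheta.Discharge.Sec1CompatOfSetting
import HarnessLib

/-!
# [EtTh] Prop. 2.2 (ii) / Def. 2.7 in the §1 model: the choice `X̲̲` from the printed inputs only

Mochizuki, *The étale theta function and its Frobenioid-theoretic manifestations*, Publ. RIMS **45**
(2009), §2, Def. 2.7 (PRIMS PDF p. 41) and Prop. 2.2 (ii) (p. 37) [cite: MochizukiEtTh2009, Def 2.7 p.41].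

Cell abc-iut, layer L2, item N3 (seat abc-iut-L2-t7): the consumer-facing constructor. The cocycle
data `XuuCocycleData` of `XuuCocycle.lean` carried, next to the genuinely new inputs (a representative
`f` of `η̈^Θ`, its mod-`l·Δ_Θ` extension `F` to `Π^tp_X̲`, the normalisation `F ≡ θ^e` over `Δ_Θ`),
four bookkeeping fields: `Compat`, `[Δ_Θ : l·Δ_Θ] = l`, "`l·Δ_Θ` open", and the two power conditions
on `e`. With the printed orientation `e = 1` (Prop. 1.3: "the natural isomorphism") the power
conditions are trivial; `Compat` follows from `K = K̈` (seat abc-iut-L2-t1, `Sec2Hyps.compat`); and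
the two `l·Δ_Θ` facts follow from seat abc-iut-L2-t8's existing input N2 `CyclotomeMod 1 l`
(`LDeltaThetaIndex.lean`). Result: `XuuCocycleData.ofCyclotomeMod` and
`doubleUnderlineOfCyclotomeMod : E.DoubleUnderline l` from EXACTLY {`Sec2Hyps`, `CyclotomeMod 1 l`,
`l` odd, `f`, `F` with its three printed properties}. Nothing here asserts that such data exist;
typed ≠ endorsed; no side is taken on any disputed claim.
-/

noncomputable section

namespace Literature.AnabelianGeometry.EtaleTheta

namespace ThetaSetting

namespace EtaleThetaData

variable {p : ℕ} [Fact p.Prime] {D : ThetaSetting p} (E : D.EtaleThetaData)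

/-- **The printed inputs for the choice of `X̲̲`** (Def. 2.7 p. 41, orientation `e = 1`): a
representative `f` of `η̈^Θ`, a continuous `F : Π^tp_X̲ → Δ_Θ` that is a cocycle modulo `l·Δ_Θ`,
restricts to `f` on `Π^tp_Ÿ` modulo `l·Δ_Θ`, and equals `θ` on the part of `Δ^tp_X̲` over `Δ_Θ`.
Data quoting print; not asserted to exist. [cite: MochizukiEtTh2009, Def 2.7 p.41] -/
structure XuuCocycleInput (l : ℕ+) where
  /-- a continuous cocycle representing `η̈^Θ` -/
  f : contCocycles D.toTheta D.DeltaTheta D.GtpYdd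
  /-- `[f] = η̈^Θ` -/
  mk_f : ContH1.mk f.1 f.2 = E.etaDd
  /-- the extension to `Π^tp_X̲`, modulo `l·Δ_Θ` -/
  F : ↥(D.GtpXu l) → ↥D.DeltaTheta
  /-- `F` is continuous -/
  continuous_F : Continuous F
  /-- `F` is a 1-cocycle modulo `l·Δ_Θ` -/
  cocycle_F : ∀ g h : ↥(D.GtpXu l),
    (F (g * h))⁻¹ * (F g * MulAut.conjNormal (D.toTheta (g : D.PiTemp)) (F h)) ∈
      (D.lDeltaTheta l).subgroupOf D.DeltaTheta
  /-- `F|_{Π^tp_Ÿ} ≡ f` modulo `l·Δ_Θ` -/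
  F_res : ∀ h : ↥D.GtpYdd,
    (F ⟨h, GtpYdd_le_GtpXu l h.2⟩)⁻¹ * f.1 h ∈ (D.lDeltaTheta l).subgroupOf D.DeltaTheta
  /-- `F(δ) ≡ θ(δ)` for `δ ∈ Δ^tp_X̲` with `θ(δ) ∈ Δ_Θ` (Prop. 1.3: "the natural isomorphism") -/
  F_theta : ∀ (δ : ↥(D.GtpXu l)) (hΔ : (δ : D.PiTemp) ∈ D.DeltaTemp)
    (hθ : D.toTheta (δ : D.PiTemp) ∈ D.DeltaTheta),
    (F δ)⁻¹ * ⟨D.toTheta (δ : D.PiTemp), hθ⟩ ∈ (D.lDeltaTheta l).subgroupOf D.DeltaTheta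

variable {E}

/-- **Cocycle data from the printed inputs**: `K = K̈` (`Sec2Hyps`), the cyclotome identification at
level `(1, l)` (t8's N2), `l` odd, and the `e = 1` input assemble to `XuuCocycleData`.
[cite: MochizukiEtTh2009, Def 2.7 p.41] -/
def XuuCocycleData.ofCyclotomeMod {l : ℕ+} (hS : D.Sec2Hyps) (μ : D.CyclotomeMod 1 l)
    (hl : Odd (l : ℕ)) (I : E.XuuCocycleInput l) : XuuCocycleData E l where
  l_odd := hl
  sec2 := hS
  compat := hS.compat
  index_lDeltaTheta := index_lDeltaTheta_of_cyclotomeMod μ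
  isOpen_lDeltaTheta := isOpen_lDeltaTheta_of_cyclotomeMod μ
  f := I.f
  mk_f := I.mk_f
  F := I.F
  continuous_F := I.continuous_F
  cocycle_F := I.cocycle_F
  F_res := I.F_res
  e := 1
  pow_surj t := ⟨t, by rw [zpow_one, inv_mul_cancel]; exact one_mem _⟩
  mem_of_pow_mem x hx := by rwa [zpow_one] at hx
  F_theta δ hΔ hθ := by rw [zpow_one]; exact I.F_theta δ hΔ hθ

/-- **The choice `X̲̲` from the printed inputs** (Prop. 2.2 (ii) / Def. 2.5 (i) / Def. 2.7 in the §1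
model): a `DoubleUnderline` in the sense of seat abc-iut-L2-t8, all fields proved, from `K = K̈`, the
cyclotome identification `Δ_Θ/l ≅ μ_l`, `l` odd and the cocycle input.
[cite: MochizukiEtTh2009, Def 2.7 p.41] -/
def doubleUnderlineOfCyclotomeMod {l : ℕ+} (hS : D.Sec2Hyps) (μ : D.CyclotomeMod 1 l)
    (hl : Odd (l : ℕ)) (I : E.XuuCocycleInput l) : E.DoubleUnderline l :=
  (XuuCocycleData.ofCyclotomeMod hS μ hl I).doubleUnderline

/-- Its `Π^tp_X̲̲` is the zero set of the cocycle input. [cite: MochizukiEtTh2009, Def 2.7 p.41] -/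
theorem doubleUnderlineOfCyclotomeMod_Huu {l : ℕ+} (hS : D.Sec2Hyps) (μ : D.CyclotomeMod 1 l)
    (hl : Odd (l : ℕ)) (I : E.XuuCocycleInput l) :
    (doubleUnderlineOfCyclotomeMod hS μ hl I).Huu = (XuuCocycleData.ofCyclotomeMod hS μ hl I).Huu :=
  rfl

end EtaleThetaData

end ThetaSetting

end Literature.AnabelianGeometry.EtaleTheta

end
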